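import Summits.AnomalousDissipation.AnomalousDissipation.Theorems.UniformResolution.Negative.SteadyStates
import Summits.AnomalousDissipation.AnomalousDissipation.Theorems.UniformResolution.Negative.ResolutionCriterion

/-!
# Negative knowledge for the crux `MomentParity.UniformResolution` (stmt-AnomalousDissipation-14330), VII:
# the N-uniform `H²` bound for Galerkin steady states and the resolution of steady Dirac masses

Certified from the cdisprove work files of refuter-cdisprove-stmt-AnomalousDissipation-14330-0 (cycle 1).
Supports stmt-AnomalousDissipation-14330; no route-item statement is asserted.

* `bootstrap_algebra`, `exists_integral_norm_sq_lapTrunc_le` — **N-UNIFORM `H²` BOUND**: for `ν > 0`, smooth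
  `f` and a radius `R` there is `C` with `∫‖ΔP_N u‖² ≤ C` for EVERY Galerkin steady state `u` at ANY level
  `N` with `‖u‖ ≤ R` (Row A: `G ≤ (‖f‖₂²+R²)/(2ν)`; Row B + weighted Young + convection bound + dyadic Agmon
  with the cut `i₀` chosen by `64·2^{-i₀}G₀ ≤ π⁴ν²`, which absorbs the `D²`-term).
* `eLapNormSq_coe_of_isLevel`, `exists_schedule_steady_resolved` — **STEADY DIRACS ARE RESOLVED, UNIFORMLY IN
  THE LEVEL**: one schedule `κ` (depending on `ν, f, R` only) with `∫‖∇u‖² ≤ ∫‖∇P_{κ n}u‖² + 1/(n+1)` against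
  `δ_u` for every `n`, every level and every steady `u` in the `R`-ball (spectral Chebyshev of
  `Negative/ResolutionCriterion.lean`). This is the resolution clause of the crux for the steady sector.
* `IsGalerkinSteady.row_polyGrad`, `isGalerkinSteady_of_rows` — band-test form ⟺ polynomial-row form.
-/

namespace Summit.AnomalousDissipation.AnomalousDissipation.Theorems.UniformResolution.Negative

open MeasureTheory Filter Topology
open scoped ENNReal InnerProductSpace RealInnerProductSpace
open Literature.Analysis.FunctionSpaces Literature.Analysis.FluidPDE
open Summit.AnomalousDissipation.AnomalousDissipation.Theorems.QuarticGate.Negative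
open Summit.AnomalousDissipation.AnomalousDissipation.Theorems

noncomputable section

/-- Local notation for the real Hilbert space `L²(T³; ℝ³)`. -/
local notation "L2T3" => Lp (EuclideanSpace ℝ (Fin 3)) 2 (volume : Measure (UnitAddTorus (Fin 3)))

section Bootstrap

variable {N : ℕ} {u : Torus.energySpace (Fin 3)} {ν : ℝ} {f : UnitAddTorus (Fin 3) → EuclideanSpace ℝ (Fin 3)}

/-! ### The bootstrap: an `N`-uniform `L²` bound on `Δū` -/

/-- The real arithmetic of the bootstrap, isolated. [folklore] -/
theorem bootstrap_algebra {ν F R nu P Q If Ifz Icz Cv D2 s1 s2 sP sQ h K G₀ : ℝ}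
    (hν : 0 < ν) (hP0 : 0 ≤ P) (hQ0 : 0 ≤ Q) (hh0 : 0 ≤ h) (hK0 : 0 ≤ K)
    (hG₀eq : 2 * ν * G₀ = F + R ^ 2) (hG₀0 : 0 ≤ G₀) (hcut : 64 * h * G₀ ≤ Real.pi ^ 4 * ν ^ 2)
    (hR2 : nu ^ 2 ≤ R ^ 2)
    (hA : ν * (4 * Real.pi ^ 2 * P) = If) (hIf : If ≤ 2⁻¹ * (F + nu ^ 2))
    (hB : ν * D2 = Ifz - Icz)
    (hY1 : Ifz ≤ 2⁻¹ * (2 / ν * F + ν / 2 * D2)) (hY2 : -Icz ≤ 2⁻¹ * (2 / ν * Cv + ν / 2 * D2))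
    (hconv : Cv ≤ (s1 * sP + s2 * sQ) ^ 2 * (4 * Real.pi ^ 2 * P))
    (hsqP : sP ^ 2 = P) (hsqQ : sQ ^ 2 = Q) (hsq1 : s1 ^ 2 = 384 * K) (hsq2 : s2 ^ 2 = 128 * h)
    (hD2Q : D2 = 16 * Real.pi ^ 4 * Q) :
    D2 ≤ 4 / ν ^ 2 * (F + 768 * K * G₀ ^ 2) := by
  have hpi : 0 < Real.pi := Real.pi_pos
  have hD20 : 0 ≤ D2 := by rw [hD2Q]; positivity
  -- Row A: G := 4π²P ≤ G₀
  have hG : 4 * Real.pi ^ 2 * P ≤ G₀ := by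
    refine le_of_mul_le_mul_left ?_ hν
    linarith
  have hG0 : 0 ≤ 4 * Real.pi ^ 2 * P := by positivity
  -- A² ≤ 768 K P + 256 h Q
  have hA2 : (s1 * sP + s2 * sQ) ^ 2 ≤ 768 * K * P + 256 * h * Q := by
    have e : (s1 * sP + s2 * sQ) ^ 2 ≤ 2 * (s1 ^ 2 * sP ^ 2) + 2 * (s2 ^ 2 * sQ ^ 2) := by
      nlinarith [sq_nonneg (s1 * sP - s2 * sQ)]
    rw [hsq1, hsq2, hsqP, hsqQ] at e
    linarith
  -- Row B: ν² D2 ≤ 2 (F + Cv)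
  have hB2 : ν ^ 2 * D2 ≤ 2 * (F + Cv) := by
    have h1 : ν * D2 ≤ 2⁻¹ * (2 / ν * F + ν / 2 * D2) + 2⁻¹ * (2 / ν * Cv + ν / 2 * D2) := by
      rw [hB]; linarith
    have e1 : ν * (2⁻¹ * (2 / ν * F + ν / 2 * D2) + 2⁻¹ * (2 / ν * Cv + ν / 2 * D2)) =
        F + Cv + ν ^ 2 / 2 * D2 := by
      field_simp
      ring
    have e2 := mul_le_mul_of_nonneg_left h1 hν.le
    rw [e1] at e2
    have e3 : ν * (ν * D2) = ν ^ 2 * D2 := by ring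
    linarith
  -- convection
  have hCv : Cv ≤ (768 * K * P + 256 * h * Q) * (4 * Real.pi ^ 2 * P) :=
    hconv.trans (mul_le_mul_of_nonneg_right hA2 hG0)
  have hPle : P ≤ 4 * Real.pi ^ 2 * P := by
    have : (1 : ℝ) ≤ 4 * Real.pi ^ 2 := by nlinarith [Real.pi_gt_three]
    have := mul_le_mul_of_nonneg_left this hP0
    linarith
  have hPG : P * (4 * Real.pi ^ 2 * P) ≤ G₀ * G₀ := mul_le_mul (hPle.trans hG) hG hG0 hG₀0
  have hKPG : K * P * (4 * Real.pi ^ 2 * P) ≤ K * (G₀ * G₀) := by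
    rw [mul_assoc]
    exact mul_le_mul_of_nonneg_left hPG hK0
  have hQG : Q * (4 * Real.pi ^ 2 * P) ≤ Q * G₀ := mul_le_mul_of_nonneg_left hG hQ0
  have hmain : ν ^ 2 * D2 ≤ 2 * F + 1536 * (K * (G₀ * G₀)) + 512 * h * (Q * G₀) := by
    have : Cv ≤ 768 * (K * P * (4 * Real.pi ^ 2 * P)) + 256 * h * (Q * (4 * Real.pi ^ 2 * P)) := by
      rw [show (768 * K * P + 256 * h * Q) * (4 * Real.pi ^ 2 * P) =
        768 * (K * P * (4 * Real.pi ^ 2 * P)) + 256 * h * (Q * (4 * Real.pi ^ 2 * P)) by ring] at hCv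
      exact hCv
    have h2 := mul_le_mul_of_nonneg_left hQG hh0
    linarith
  -- absorb the D2-term: 512 h Q G₀ ≤ ν² D2 / 2
  have habs : 512 * h * (Q * G₀) ≤ ν ^ 2 * D2 / 2 := by
    have h1 : 64 * h * G₀ * Q ≤ Real.pi ^ 4 * ν ^ 2 * Q := mul_le_mul_of_nonneg_right hcut hQ0
    rw [hD2Q]
    have e1 : 512 * h * (Q * G₀) = 8 * (64 * h * G₀ * Q) := by ring
    have e2 : ν ^ 2 * (16 * Real.pi ^ 4 * Q) / 2 = 8 * (Real.pi ^ 4 * ν ^ 2 * Q) := by ring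
    rw [e1, e2]
    linarith
  have hfin : ν ^ 2 * D2 ≤ 4 * F + 3072 * (K * (G₀ * G₀)) := by linarith
  rw [div_mul_eq_mul_div, le_div_iff₀ (by positivity)]
  have e : G₀ ^ 2 = G₀ * G₀ := sq G₀
  rw [e]
  linarith

/-- **N-UNIFORM `H²` BOUND FOR GALERKIN STEADY STATES.** For `ν > 0`, smooth `f` and a radius `R`
there is `C` such that EVERY Galerkin steady state `u` at ANY level `N` with `‖u‖ ≤ R` has
`∫ ‖Δū‖² ≤ C` (`ū = P_N u`). Proof: Row A gives `G ≤ (‖f‖₂² + R²)/(2ν)`; Row B with the weighted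
Young inequality gives `D² ≤ 2ν⁻²(‖f‖₂² + ∫‖(ū·∇)ū‖²)`; the convection term is `≤ ‖ū‖_∞² G` and the
dyadic Agmon inequality `‖ū‖_∞² ≤ 768·4^{i₀} G + 16·2^{-i₀} D²/π⁴` with `i₀` chosen so that
`64·2^{-i₀} G₀ ≤ π⁴ν²` absorbs the `D²` term. [folklore] -/
theorem exists_integral_norm_sq_lapTrunc_le (hν : 0 < ν) (hf : Torus.IsSmooth f) (R : ℝ) :
    ∃ C : ℝ, 0 ≤ C ∧ ∀ (N : ℕ) (u : Torus.energySpace (Fin 3)), IsLevel N u → ‖u‖ ≤ R →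
      IsGalerkinSteady ν f N u → ∫ x, ‖lapTrunc N u x‖ ^ 2 ≤ C := by
  have hF0 : 0 ≤ ∫ x, ‖f x‖ ^ 2 := integral_nonneg fun x => by positivity
  have hpi : 0 < Real.pi := Real.pi_pos
  set G₀ : ℝ := ((∫ x, ‖f x‖ ^ 2) + R ^ 2) / (2 * ν) with hG₀
  have hG₀0 : 0 ≤ G₀ := by positivity
  have hG₀eq : 2 * ν * G₀ = (∫ x, ‖f x‖ ^ 2) + R ^ 2 := by rw [hG₀]; field_simp
  obtain ⟨i₀, hi₀⟩ := exists_pow_lt_of_lt_one (show 0 < Real.pi ^ 4 * ν ^ 2 / (64 * G₀ + 1) by positivity)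
    (show (2 : ℝ)⁻¹ < 1 by norm_num)
  have hh0 : 0 ≤ ((2 : ℝ)⁻¹) ^ i₀ := by positivity
  have hcut : 64 * ((2 : ℝ)⁻¹) ^ i₀ * G₀ ≤ Real.pi ^ 4 * ν ^ 2 := by
    have h1 : ((2 : ℝ)⁻¹) ^ i₀ * (64 * G₀ + 1) < Real.pi ^ 4 * ν ^ 2 := by
      rwa [lt_div_iff₀ (by positivity)] at hi₀
    nlinarith
  refine ⟨4 / ν ^ 2 * ((∫ x, ‖f x‖ ^ 2) + 768 * (4 : ℝ) ^ i₀ * G₀ ^ 2), by positivity,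
    fun N u hu hR hst => ?_⟩
  have hS := Torus.isSmooth_fourierTruncate N ((u.1 : L2T3) : UnitAddTorus (Fin 3) → EuclideanSpace ℝ (Fin 3))
  change Torus.IsSmooth (trunc N u) at hS
  have hZ : Torus.IsSmooth (lapTrunc N u) := Torus.isSmooth_realTrigPoly _ _
  -- analytic facts
  have hA := rowA_eq hf hu hst
  have hIf := (le_abs_self _).trans (abs_integral_inner_le_weighted (hf.memLp 2) (hS.memLp 2) one_pos)
  rw [integral_norm_sq_trunc u hu, one_mul, inv_one, one_mul] at hIf
  have hB := rowB_eq hf hu hst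
  have ha : 0 < 2 / ν := by positivity
  have hY1 := (le_abs_self _).trans (abs_integral_inner_le_weighted (hf.memLp 2) (hZ.memLp 2) ha)
  have hY2 := (neg_le_abs _).trans
    (abs_integral_inner_le_weighted ((hS.convect hS).memLp 2) (hZ.memLp 2) ha)
  have hinv : (2 / ν)⁻¹ = ν / 2 := by rw [inv_div]
  rw [hinv] at hY1 hY2
  have hAx : ∀ x, ‖trunc N u x‖ ≤ _ := fun x => norm_trunc_le (u := u) i₀ x
  have hconv := integral_norm_sq_convect_self_le hS hAx
  rw [integral_sum_norm_sq_partialDeriv_trunc u] at hconv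
  have hP0 : 0 ≤ ∑ k ∈ Torus.freqBall N, Torus.freqNormSq k * ‖coef u k‖ ^ 2 :=
    Finset.sum_nonneg fun k _ => mul_nonneg (Torus.freqNormSq_nonneg _) (sq_nonneg _)
  have hQ0 : 0 ≤ ∑ k ∈ Torus.freqBall N, Torus.freqNormSq k ^ 2 * ‖coef u k‖ ^ 2 :=
    Finset.sum_nonneg fun k _ => mul_nonneg (sq_nonneg _) (sq_nonneg _)
  have hR2 : ‖u‖ ^ 2 ≤ R ^ 2 := by
    have := norm_nonneg u
    nlinarith
  exact bootstrap_algebra hν hP0 hQ0 hh0 (by positivity) hG₀eq hG₀0 hcut hR2 hA hIf hB hY1 hY2 hconv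
    (Real.sq_sqrt hP0) (Real.sq_sqrt hQ0) (Real.sq_sqrt (by positivity)) (Real.sq_sqrt (by positivity))
    (integral_norm_sq_lapTrunc u)

end Bootstrap

/-! ## 6. Resolution of Dirac masses at Galerkin steady states, uniformly in the level -/

section Resolution


variable {N : ℕ} (u : Torus.energySpace (Fin 3))

/-- For a level-`N` field, the spectral `|Au|²` of the representative is `∫ ‖Δū‖²`. [folklore] -/
theorem eLapNormSq_coe_of_isLevel (hu : IsLevel N u) :
    eLapNormSq ((u.1 : L2T3) : UnitAddTorus (Fin 3) → EuclideanSpace ℝ (Fin 3)) =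
      ENNReal.ofReal (∫ x, ‖lapTrunc N u x‖ ^ 2) := by
  rw [integral_norm_sq_lapTrunc u, eLapNormSq]
  have hzero : ∀ k ∉ Torus.freqBall N, ENNReal.ofReal (Torus.freqNormSq k) ^ 2 *
      ‖UnitAddTorus.mFourierCoeff (EuclideanSpace.complexify ∘
        ((u.1 : L2T3) : UnitAddTorus (Fin 3) → EuclideanSpace ℝ (Fin 3))) k‖ₑ ^ 2 = 0 := by
    intro k hk
    have : UnitAddTorus.mFourierCoeff (EuclideanSpace.complexify ∘
        ((u.1 : L2T3) : UnitAddTorus (Fin 3) → EuclideanSpace ℝ (Fin 3))) k = 0 :=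
      hu k fun h => hk (Finset.mem_of_mem_erase h)
    rw [this]
    simp
  rw [tsum_eq_sum (s := Torus.freqBall N) hzero]
  have e : ENNReal.ofReal (16 * Real.pi ^ 4 * ∑ k ∈ Torus.freqBall N, Torus.freqNormSq k ^ 2 * ‖coef u k‖ ^ 2) =
      ENNReal.ofReal (16 * Real.pi ^ 4) *
        ENNReal.ofReal (∑ k ∈ Torus.freqBall N, Torus.freqNormSq k ^ 2 * ‖coef u k‖ ^ 2) :=
    ENNReal.ofReal_mul (by positivity)
  rw [e, ENNReal.ofReal_sum_of_nonneg fun k _ => mul_nonneg (sq_nonneg _) (sq_nonneg _)]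
  congr 1
  refine Finset.sum_congr rfl fun k _ => ?_
  rw [ENNReal.ofReal_mul (sq_nonneg _), ENNReal.ofReal_pow (Torus.freqNormSq_nonneg _),
    ← ofReal_norm, ← ENNReal.ofReal_pow (norm_nonneg _)]
  rfl

/-- **STEADY DIRACS ARE RESOLVED, UNIFORMLY IN THE LEVEL.** For `ν > 0`, smooth `f` and a radius `R`
there is ONE schedule `κ` such that for EVERY level `N` and EVERY Galerkin steady state `u` at level `N`
with `‖u‖ ≤ R`, `∫‖∇u‖² ≤ ∫‖∇P_{κ n}u‖² + 1/(n+1)` against `δ_u` for all `n` (the resolution clause of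
the crux). From the `N`-uniform `H²` bound and spectral Chebyshev. [folklore] -/
theorem exists_schedule_steady_resolved {ν : ℝ} (hν : 0 < ν)
    {f : UnitAddTorus (Fin 3) → EuclideanSpace ℝ (Fin 3)} (hf : Torus.IsSmooth f) (R : ℝ) :
    ∃ κ : ℕ → ℕ, ∀ (N : ℕ) (u : Torus.energySpace (Fin 3)), IsLevel N u → ‖u‖ ≤ R →
      IsGalerkinSteady ν f N u → ∀ n : ℕ,
        ∫⁻ v, Torus.eGradNormSq (v.1 : UnitAddTorus (Fin 3) → EuclideanSpace ℝ (Fin 3)) ∂(Measure.dirac u) ≤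
          (∫⁻ v, Torus.eGradNormSq (Torus.fourierTruncate (κ n)
            (v.1 : UnitAddTorus (Fin 3) → EuclideanSpace ℝ (Fin 3))) ∂(Measure.dirac u)) +
            ((n : ENNReal) + 1)⁻¹ := by
  haveI : MeasurableSingletonClass (Torus.energySpace (Fin 3)) :=
    OpensMeasurableSpace.toMeasurableSingletonClass
  obtain ⟨C, hC0, hC⟩ := exists_integral_norm_sq_lapTrunc_le hν hf R
  -- κ n with C (n+1) ≤ 4π²(κ² + 1): take κ n = ⌈C (n+1)⌉₊
  refine ⟨fun n => ⌈C * ((n : ℝ) + 1)⌉₊, fun N u hu hR hst n => ?_⟩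
  set m : ℕ := ⌈C * ((n : ℝ) + 1)⌉₊ with hm
  have hint : Integrable ((u.1 : L2T3) : UnitAddTorus (Fin 3) → EuclideanSpace ℝ (Fin 3)) volume :=
    (Lp.memLp (u.1 : L2T3)).integrable one_le_two
  rw [lintegral_dirac, lintegral_dirac, eGradNormSq_eq_fourierTruncate_add_tail hint m]
  gcongr
  -- tail ≤ eLap / (4π²(m²+1)) ≤ C/(4π²(m²+1)) ≤ (n+1)⁻¹
  set X : ℝ≥0∞ := ENNReal.ofReal (4 * Real.pi ^ 2 * ((m : ℝ) ^ 2 + 1)) with hX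
  have hX0 : X ≠ 0 := (ENNReal.ofReal_pos.2 (by positivity)).ne'
  have hXtop : X ≠ ⊤ := ENNReal.ofReal_ne_top
  have h1 : Torus.tailGradNormSq m ((u.1 : L2T3) : UnitAddTorus (Fin 3) → EuclideanSpace ℝ (Fin 3)) ≤
      ENNReal.ofReal C / X := by
    rw [ENNReal.le_div_iff_mul_le (Or.inl hX0) (Or.inl hXtop)]
    refine (tailGradNormSq_mul_le_eLapNormSq m _).trans ?_
    rw [eLapNormSq_coe_of_isLevel u hu]
    exact ENNReal.ofReal_le_ofReal (hC N u hu hR hst)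
  refine h1.trans ?_
  rw [ENNReal.div_le_iff_le_mul (Or.inl hX0) (Or.inl hXtop)]
  -- ofReal C ≤ (n+1)⁻¹ * X  ⟸  C * (n+1) ≤ 4π²(m²+1)
  have hkey : C * ((n : ℝ) + 1) ≤ 4 * Real.pi ^ 2 * ((m : ℝ) ^ 2 + 1) := by
    have hmle : C * ((n : ℝ) + 1) ≤ m := Nat.le_ceil _
    have hpi : 3 < Real.pi := Real.pi_gt_three
    have h1 : (m : ℝ) ≤ (m : ℝ) ^ 2 + 1 := by nlinarith [sq_nonneg ((m : ℝ) - 1)]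
    have h3 : (0 : ℝ) ≤ (m : ℝ) ^ 2 + 1 := by positivity
    have h4 : (1 : ℝ) ≤ 4 * Real.pi ^ 2 := by nlinarith
    have h2 : (m : ℝ) ^ 2 + 1 ≤ 4 * Real.pi ^ 2 * ((m : ℝ) ^ 2 + 1) := by
      have := mul_le_mul_of_nonneg_right h4 h3
      linarith
    linarith
  have hn : ((n : ℝ≥0∞) + 1) = ENNReal.ofReal ((n : ℝ) + 1) := by
    rw [ENNReal.ofReal_add (Nat.cast_nonneg _) zero_le_one, ENNReal.ofReal_natCast, ENNReal.ofReal_one]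
  have hn0 : ((n : ℝ≥0∞) + 1) ≠ 0 := by simp
  have hntop : ((n : ℝ≥0∞) + 1) ≠ ⊤ := by simp
  calc ENNReal.ofReal C = ((n : ℝ≥0∞) + 1)⁻¹ * (((n : ℝ≥0∞) + 1) * ENNReal.ofReal C) := by
        rw [← mul_assoc, ENNReal.inv_mul_cancel hn0 hntop, one_mul]
    _ ≤ ((n : ℝ≥0∞) + 1)⁻¹ * X := by
        gcongr
        rw [hn, hX, ← ENNReal.ofReal_mul (by positivity)]
        apply ENNReal.ofReal_le_ofReal
        nlinarith

end Resolution

/-! ## 7. Band-test form versus polynomial-row form of steadiness -/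

section Bridge

/-- Rows of polynomial cylindrical tests vanish at a Galerkin steady state (linearity of the tested
generator in the test field). [folklore] -/
theorem IsGalerkinSteady.row_polyGrad {ν : ℝ} {f : UnitAddTorus (Fin 3) → EuclideanSpace ℝ (Fin 3)}
    (hf : Torus.IsSmooth f) {N : ℕ} {u : Torus.energySpace (Fin 3)} (hst : IsGalerkinSteady ν f N u)
    {m : ℕ} (g : Fin m → UnitAddTorus (Fin 3) → EuclideanSpace ℝ (Fin 3)) (P : MvPolynomial (Fin m) ℝ)
    (hg : ∀ i, IsBandTest N (g i)) : Torus.nsGeneratorPairing ν f u (polyGrad g P u) = 0 := by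
  have h := Torus.nsGeneratorPairing_sum_smul ν hf.continuous.integrable_unitAddTorus u Finset.univ
    (fun i => MvPolynomial.eval (fun j => Torus.pairing u.1 (g j)) (MvPolynomial.pderiv i P))
    (g := g) fun i _ => (hg i).1
  change Torus.nsGeneratorPairing ν f u (fun x => ∑ i, MvPolynomial.eval (fun j => Torus.pairing u.1 (g j))
    (MvPolynomial.pderiv i P) • g i x) = 0
  rw [h]
  exact Finset.sum_eq_zero fun i _ => by rw [hst (g i) (hg i), mul_zero]

/-- Conversely the polynomial-row form gives the band-test form (`m = 1`, `g₀ = w`, `P = X₀`). [folklore] -/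
theorem isGalerkinSteady_of_rows {ν : ℝ} {f : UnitAddTorus (Fin 3) → EuclideanSpace ℝ (Fin 3)} {N : ℕ}
    {u : Torus.energySpace (Fin 3)}
    (h : ∀ (m : ℕ) (g : Fin m → UnitAddTorus (Fin 3) → EuclideanSpace ℝ (Fin 3)) (P : MvPolynomial (Fin m) ℝ),
      (∀ i, IsBandTest N (g i)) → Torus.nsGeneratorPairing ν f u (polyGrad g P u) = 0) :
    IsGalerkinSteady ν f N u := fun w hw => by
  have h1 := h 1 (fun _ => w) (MvPolynomial.X 0) fun _ => hw
  have e : polyGrad (fun _ : Fin 1 => w) (MvPolynomial.X 0) u = w := by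
    funext x
    simp [polyGrad, MvPolynomial.pderiv_X]
  rwa [e] at h1

end Bridge

end

end Summit.AnomalousDissipation.AnomalousDissipation.Theorems.UniformResolution.Negative
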